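import Summits.Langlands.Langlands.Statement
import Summits.Langlands.Langlands.Theorems.IrreducibilityBySelfDualityReciprocityUpToIrreducibilitySphericalWhittakerCorner
import Literature.NumberTheory.Automorphic.GL2UnramifiedLFactorDivisibility
import HarnessLib

/-!
# Line `Sketch` for the crux `ReciprocityUpToIrreducibility` (item stmt-Langlands-14328), continuation c6:
# stub S3 — moving a Whittaker functional along the diagonal torus does not change the corner values

Support file (closes nothing; continuation lead c6, stub S3 `stub_whittaker_corner_diagonal_comm`).

Let `F` be a field, `1 < n`, `π` a representation of `GL_n(F)` on `V`, `Λ` a linear form on `V`,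
`v ∈ V` and `D = diagonalGL (Fin n) F d` a diagonal torus element.  On the corner torus
`c(h) = glCorner F _ (glDiagonal 1 F h) = diag(h, 1, …, 1)` we prove:

* `glCorner_glDiagonal_fin_one_mul_diagonalGL_comm` — `c(h) D = D c(h)` (both are values of the
  monoid hom `diagonalGL (Fin n) F` on the commutative group `(Fˣ)ⁿ`);
* `dual_comp_rep_ne_zero` — `Λ ∘ π(g) ≠ 0` for `Λ ≠ 0` (`π(g)` is invertible);
* `stub_whittaker_corner_diagonal_comm` — (1) `W_{π(D) v}^{Λ}(c(h)) = W_v^{Λ ∘ π(D)}(c(h))`, i.e.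
  `Λ(π(c(h)) π(D) v) = Λ(π(D) π(c(h)) v)`, and (2) `Λ ≠ 0 → Λ ∘ π(D) ≠ 0`.

This is the rank-`n` form of `whittakerModel_apply_diagGL2_diagGL2_eq_comp` and
`comp_ne_zero_of_ne_zero` (`GL2UnramifiedLFactorDivisibility`, `n = 2`); it lets the `(n, 1)`
Rankin–Selberg zeta integral of `π(D) v` against `Λ` be rewritten as that of `v` against the
shifted Whittaker functional `Λ ∘ π(D)` (Cogdell 2004, §3.1).  No definitions; std axioms.
-/

open scoped MatrixGroups Matrix NumberField Classical Polynomial NNReal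
open Filter IsDedekindDomain Field Polynomial MeasureTheory Literature.NumberTheory.Automorphic
  Literature.NumberTheory.GaloisRepresentations Literature.NumberTheory.PAdicHodge Summit.Langlands

noncomputable section
set_option linter.dupNamespace false -- project-wide option (lakefile weak.linter.dupNamespace); `Summit.Langlands.Langlands` is the mandated namespace

namespace Summit.Langlands.Langlands.Theorems.ReciprocityUpToIrreducibility

/-- **The corner torus commutes with the diagonal torus**:
`diag(h, 1, …, 1) · diag(d) = diag(d) · diag(h, 1, …, 1)` in `GL_n(F)` (the diagonal torus
`(Fˣ)ⁿ →* GL_n(F)` has commutative source). [folklore] -/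
theorem glCorner_glDiagonal_fin_one_mul_diagonalGL_comm {F : Type*} [Field F] {n : ℕ}
    (hn : 1 ≤ n) (h : Fˣ) (d : Fin n → Fˣ) :
    glCorner F hn (glDiagonal 1 F fun _ => h) * diagonalGL (Fin n) F d =
      diagonalGL (Fin n) F d * glCorner F hn (glDiagonal 1 F fun _ => h) := by
  rw [glCorner_glDiagonal_fin_one_eq_diagonalGL, ← map_mul, ← map_mul, mul_comm]

/-- **`Λ ∘ π(g) ≠ 0` for `Λ ≠ 0`**: `π(g)` is invertible with inverse `π(g⁻¹)`, so
`Λ = (Λ ∘ π(g)) ∘ π(g⁻¹)` (rank-`n` form of `comp_ne_zero_of_ne_zero`). [folklore] -/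
theorem dual_comp_rep_ne_zero {F : Type*} [Field F] {n : ℕ} {V : Type*} [AddCommGroup V]
    [Module ℂ V] (π : Representation ℂ (GL (Fin n) F) V) {Λ : Module.Dual ℂ V} (hΛ : Λ ≠ 0)
    (g : GL (Fin n) F) : Λ ∘ₗ (π g : V →ₗ[ℂ] V) ≠ 0 := by
  -- adapted from `comp_ne_zero_of_ne_zero` (`GL2UnramifiedLFactorDivisibility`, `n = 2`)
  intro h
  apply hΛ
  ext v
  have := LinearMap.congr_fun h (π g⁻¹ v)
  rw [LinearMap.comp_apply, ← Module.End.mul_apply, ← map_mul, mul_inv_cancel, map_one,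
    Module.End.one_apply] at this
  rw [this, LinearMap.zero_apply, LinearMap.zero_apply]

/-- **stub S3 (moving the Whittaker functional along the diagonal torus).**  For a linear form
`Λ` on `V`, `v ∈ V` and a diagonal torus element `D = diagonalGL (Fin n) F d`, the Whittaker
function `W_{π(D) v}^{Λ}(g) = Λ(π(g) π(D) v)` agrees on the corner torus
`c(h) = diag(h, 1, …, 1)` with `W_v^{Λ ∘ π(D)}(g) = Λ(π(D) π(g) v)` — both tori are diagonal,
so `c(h) D = D c(h)` — and `Λ ∘ π(D) ≠ 0` whenever `Λ ≠ 0` (`π(D)` is invertible).  With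
`comp_diagonalGL_mem_whittakerFunctionals` this moves a `ψ`-Whittaker functional to an
`aψ`-Whittaker functional without changing the `GL_n × GL₁` zeta integrals, which only sample
the Whittaker function on the corner torus.  Rank-`n` form of
`whittakerModel_apply_diagGL2_diagGL2_eq_comp` / `comp_ne_zero_of_ne_zero`.
(Cogdell 2004, §3.1: translating the test vector changes the additive character.)
[cite: CogdellAnalyticTheory2004, §3.1] -/
theorem stub_whittaker_corner_diagonal_comm :
    ∀ (F : Type) [Field F] (n : ℕ) (hn : 1 < n) (V : Type) [AddCommGroup V] [Module ℂ V]
      (π : Representation ℂ (GL (Fin n) F) V) (Λ : Module.Dual ℂ V) (v : V) (d : Fin n → Fˣ),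
      (∀ h : Fˣ,
        whittakerModel π Λ (π (diagonalGL (Fin n) F d) v) (glCorner F hn.le (glDiagonal 1 F fun _ => h)) =
          whittakerModel π (Λ ∘ₗ π (diagonalGL (Fin n) F d)) v
            (glCorner F hn.le (glDiagonal 1 F fun _ => h))) ∧
      (Λ ≠ 0 → Λ ∘ₗ π (diagonalGL (Fin n) F d) ≠ 0) := by
  -- adapted from `whittakerModel_apply_diagGL2_diagGL2_eq_comp` and `comp_ne_zero_of_ne_zero`
  -- (`GL2UnramifiedLFactorDivisibility`, `n = 2`)
  intro F _ n hn V _ _ π Λ v d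
  refine ⟨fun h => ?_, fun hΛ => dual_comp_rep_ne_zero π hΛ _⟩
  rw [whittakerModel_apply, whittakerModel_apply, LinearMap.comp_apply, ← Module.End.mul_apply,
    ← map_mul, ← Module.End.mul_apply, ← map_mul,
    glCorner_glDiagonal_fin_one_mul_diagonalGL_comm hn.le h d]

end Summit.Langlands.Langlands.Theorems.ReciprocityUpToIrreducibility
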